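import Literature.MathematicalPhysics.QuantumLattice.FermionBlockProductState
import Literature.MathematicalPhysics.QuantumLattice.FermionBoxProductEntropy
import Literature.MathematicalPhysics.QuantumLattice.TransferOperatorDual
import HarnessLib

/-!
# Region entropies of block product states: `S((⊗_i ρ_i)|_Λ) = Σ_{i ∈ classes Λ} S(tr_{Λ∩B_i} ρ_i)` for faithful
# even block states, and the full-block lower bound `S((⊗ρ)|_Λ) ≥ Σ_{B_i ⊆ Λ} S(ρ_i)`

Topic `Literature/MathematicalPhysics/QuantumLattice` (family `hubbard`, model-free). Companion of
`FermionBlockProductState.lean` (the Araki–Moriya product `⊗_i ρ_i` of even block density matrices over a partition of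
`ℤ^d` into finite blocks; its density matrix on `Λ` is the box product of the embedded block marginals,
`rdm_blockProductState`). With `FermionBoxProductEntropy.vonNeumannEntropy_boxProd` (additivity of the von Neumann entropy
over a box product of FAITHFUL even density matrices, via the modular Hamiltonian — no Jordan–Wigner order needed, so
the blocks may interleave in the lexicographic order of `ℤ^d`) this gives the entropy bookkeeping of the trial states of
the Gibbs variational principle:

* §1 `posDef_fermionPartialTrace` — **marginals of faithful states are faithful** (`tr(P · tr_φ ρ) = tr(Γ_φ P · ρ) > 0` for a
  rank-one projector `P`); `vonNeumannEntropy_fermionPartialTrace_incl_of_eq` (the marginal along an inclusion of EQUAL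
  regions has the same entropy).
* §2 `vonNeumannEntropy_boxProd_finset` — the `Finset`-indexed form of the additivity theorem
  (`S(Π_{k∈S} Γ_k σ_k) = Σ_{k∈S} S(σ_k)` for faithful even `σ_k` on boxes tiling the ambient region).
* §3 **`vonNeumannEntropy_rdm_blockProductState`**: for faithful even block states,
  `S((⊗ρ)|_Λ) = Σ_{i ∈ classes Λ} S(tr_{Λ∩B_i ⊆ B_i} ρ_i)`; full blocks contribute `S(ρ_i)`
  (`vonNeumannEntropy_blockMarginal_of_block_subset`), so **`Σ_{i ∈ classes Λ, B_i ⊆ Λ} S(ρ_i) ≤ S((⊗ρ)|_Λ)`**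
  (`sum_vonNeumannEntropy_le_rdm_blockProductState`) and, for a uniform floor `s ≤ S(ρ_i)`,
  `#{i ∈ classes Λ : B_i ⊆ Λ} · s ≤ S((⊗ρ)|_Λ)`; regions that are unions of blocks: `S = Σ S(ρ_i)` exactly.

Everything is PROVED; no definition, no named fact. HONEST SCOPE: faithfulness (`PosDef`) of the block states is assumed
for the entropy formula (Gibbs states are faithful); the non-faithful case would go through the Jordan–Wigner route of
`FermionProductStateEntropy` after a block-major relabelling and is not needed downstream.

## Tree / Mathlib search

REUSED: `rdm_blockProductState`, `blockDensity_def`, `blockMarginal`, `BlockPartition.*` (`FermionBlockProductState`);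
`boxProd`, `normTrace_boxProd`, `normTrace_boxProd_mul_fermionEmbed`, `pairwise_commute_fermionEmbed_box` (`FermionBoxProductMarginals`);
`parityAut_cfc_of_parityAut_eq`, `exp_cfc_log_of_posDef` (`FermionBoxProductEntropy`); `re_trace_mul_pos`, `im_trace_mul_of_isHermitian`
(`TransferOperatorDual`), `trace_re_pos_of_posSemidef` (`TransferOperatorPerron`); `fermionPartialTrace` API incl.
`vonNeumannEntropy_fermionPartialTrace_eq_of_range_eq`, `fermionPartialTrace_refl`; `IsHermitian.vonNeumannEntropy_gibbsDensity`,
`re_trace_mul_cfc_log`, `vonNeumannEntropy_nonneg`; Mathlib `Matrix.PosDef.of_dotProduct_mulVec_pos`, `posSemidef_vecMulVec_self_star`,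
`Matrix.exp_sum_of_commute`. `lean search 'posDef_fermionPartialTrace|entropy.*blockProduct'` (2026-08-28): nothing.

## References

* H. Araki, H. Moriya, Rev. Math. Phys. 15 (2003) 93, §10 (entropy of restrictions, mean entropy), §11.1 Thm. 11.2.
  [cite: ArakiMoriya2003, Theorem 3.8 and §10]
* O. Bratteli, D. W. Robinson, *OAQSM 2* (1997), Prop. 6.2.38 / Thm. 6.2.40 (entropy of product states over box tilings
  in the proof of the variational principle). [cite: BratteliRobinsonII1997, Thm. 6.2.40]
* M. A. Nielsen, I. L. Chuang, *QCQI* (2010), §11.3.4 eq. (11.58) (additivity of entropy). [cite: NielsenChuang2010, §11.3.4 eq. (11.58)]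
-/

noncomputable section

namespace Literature.MathematicalPhysics.QuantumLattice

open Matrix Finset HubbardWave0 Literature.Probability.LatticeModels
open scoped ComplexOrder BigOperators
open Literature.InformationTheory.Entropy (vonNeumannEntropy vonNeumannEntropy_nonneg re_trace_mul_cfc_log)

/-! ### §1. Marginals of faithful states are faithful -/

section Faithful

variable {Λ Λ' : Type*} [LinearOrder Λ] [Fintype Λ] [LinearOrder Λ'] [Fintype Λ']

/-- `⟨x, M x⟩ = tr(|x⟩⟨x| · M)`. [cite: NielsenChuang2010, §2.4.3 Box 2.6 eqs. (2.181)–(2.182)] -/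
private theorem dotProduct_mulVec_eq_trace_vecMulVec_mul {κ : Type*} [Fintype κ] (x : κ → ℂ) (M : Matrix κ κ ℂ) :
    star x ⬝ᵥ (M *ᵥ x) = (vecMulVec x (star x) * M).trace := by
  simp only [dotProduct, mulVec, Matrix.trace, Matrix.diag, Matrix.mul_apply, vecMulVec_apply, Pi.star_apply,
    Finset.mul_sum]
  rw [Finset.sum_comm]
  refine Finset.sum_congr rfl fun i _ => Finset.sum_congr rfl fun j _ => ?_
  ring

/-- **The fermionic partial trace of a FAITHFUL state is faithful**: `ρ ≻ 0 ⇒ tr_φ ρ ≻ 0`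
(`⟨x, tr_φ ρ x⟩ = tr(Γ_φ(|x⟩⟨x|) ρ) > 0`: `Γ_φ` of a non-zero positive operator is non-zero positive).
[cite: ArakiMoriya2003, §4.1 Def. 4.5] -/
theorem posDef_fermionPartialTrace (φ : Λ ↪ Λ') {ρ : Matrix (Finset (Orb Λ')) (Finset (Orb Λ')) ℂ} (hρ : ρ.PosDef) :
    (fermionPartialTrace φ ρ).PosDef := by
  refine PosDef.of_dotProduct_mulVec_pos (isHermitian_fermionPartialTrace φ hρ.1) fun x hx => ?_
  have hP : (vecMulVec x (star x)).PosSemidef := posSemidef_vecMulVec_self_star x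
  have hΓ : (fermionEmbed φ (vecMulVec x (star x))).PosSemidef := posSemidef_fermionEmbed φ hP
  -- `Γ P ≠ 0`: its trace is `2^Δ tr P = 2^Δ ‖x‖² ≠ 0`
  have hP0 : vecMulVec x (star x) ≠ 0 := fun h => by
    have htr : (vecMulVec x (star x)).trace = star x ⬝ᵥ x := by rw [trace_vecMulVec, dotProduct_comm]
    rw [h, trace_zero] at htr
    exact hx (dotProduct_star_self_eq_zero.1 htr.symm)
  have hΓ0 : fermionEmbed φ (vecMulVec x (star x)) ≠ 0 := fun h => by
    have h1 := trace_fermionEmbed φ (vecMulVec x (star x))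
    rw [h, trace_zero] at h1
    have h2 : (vecMulVec x (star x)).trace ≠ 0 := fun h0 => hP0 (hP.trace_eq_zero_iff.1 h0)
    exact h2 ((mul_eq_zero.1 h1.symm).resolve_left (pow_ne_zero _ two_ne_zero))
  rw [dotProduct_mulVec_eq_trace_vecMulVec_mul, trace_mul_fermionPartialTrace, Matrix.trace_mul_comm]
  have hre := re_trace_mul_pos hρ hΓ hΓ0
  have him := im_trace_mul_of_isHermitian hρ.1 hΓ.1
  rw [Complex.lt_def]
  exact ⟨by simpa using hre, by simpa using him.symm⟩

/-- The marginal along an inclusion of EQUAL regions has the same entropy (it is a relabelling).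
[cite: ArakiMoriya2003, §3.1 and §10] -/
theorem vonNeumannEntropy_fermionPartialTrace_incl_of_eq {d : ℕ} {X Y : Finset (Site d)} (h : X ⊆ Y) (hXY : X = Y)
    {ρ : FermionOp Y} (hρ : ρ.IsHermitian) : vonNeumannEntropy (fermionPartialTrace (PolySite.incl h) ρ) = vonNeumannEntropy ρ := by
  subst hXY
  rw [PolySite.incl_rfl, fermionPartialTrace_refl]

end Faithful

/-! ### §2. Entropy additivity over a `Finset`-indexed box product of faithful even density matrices -/

section BoxProdFinset

variable {Λ : Type*} [LinearOrder Λ] [Fintype Λ] {K : Type*} [DecidableEq K]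
  {Λ₀ : K → Type*} [∀ k, LinearOrder (Λ₀ k)] [∀ k, Fintype (Λ₀ k)]
  {φ : ∀ k, Λ₀ k ↪ Λ}
  (hφ : ∀ k j, k ≠ j → Disjoint ((Finset.univ : Finset (Λ₀ k)).map (φ k)) ((Finset.univ : Finset (Λ₀ j)).map (φ j)))
include hφ

omit hφ in
/-- Orbital count `|Orb X| = 2|X|` (re-derived). [folklore] -/
private theorem card_orb_eq_two_mul'' (X : Type*) [LinearOrder X] [Fintype X] : Fintype.card (Orb X) = 2 * Fintype.card X := by
  rw [Fintype.card_congr (show Orb X ≃ X × Fin 2 from (toLex : X × Fin 2 ≃ Orb X).symm), Fintype.card_prod, Fintype.card_fin, mul_comm]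

omit [DecidableEq K] hφ in
/-- For boxes indexed by `S` tiling `Λ` (`Σ_{k∈S} |Λ₀ k| = |Λ|`): `2^{|Orb Λ|} = Π_{k∈S} 2^{|Orb (Λ₀ k)|}`. [folklore] -/
private theorem two_pow_card_orb_eq_prod_finset {S : Finset K} (hcard : ∑ k ∈ S, Fintype.card (Λ₀ k) = Fintype.card Λ) :
    (2 : ℂ) ^ Fintype.card (Orb Λ) = ∏ k ∈ S, (2 : ℂ) ^ Fintype.card (Orb (Λ₀ k)) := by
  rw [Finset.prod_pow_eq_pow_sum, card_orb_eq_two_mul'']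
  simp_rw [card_orb_eq_two_mul'']
  rw [← Finset.mul_sum, hcard]

/-- `tr Π_{k∈S} Γ_k σ_k = 1` for density matrices on boxes indexed by `S` tiling `Λ`. [cite: ArakiMoriya2003, §11.1 Theorem 11.2] -/
theorem trace_boxProd_eq_one_of_sum_card {σ : ∀ k, Matrix (Finset (Orb (Λ₀ k))) (Finset (Orb (Λ₀ k))) ℂ}
    (hσ : ∀ k, parityAut (σ k) = σ k) {S : Finset K} (htr : ∀ k ∈ S, (σ k).trace = 1)
    (hcard : ∑ k ∈ S, Fintype.card (Λ₀ k) = Fintype.card Λ) : (boxProd hφ σ hσ S).trace = 1 := by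
  have h := normTrace_boxProd hφ hσ S
  rw [Finset.prod_congr rfl fun k hk => show normTrace (σ k) = ((2 : ℂ) ^ Fintype.card (Orb (Λ₀ k)))⁻¹ by
    rw [normTrace_apply, htr k hk, one_div]] at h
  rw [normTrace_apply, Finset.prod_inv_distrib, ← two_pow_card_orb_eq_prod_finset hcard, div_eq_iff (pow_ne_zero _ two_ne_zero)] at h
  rw [h, inv_mul_cancel₀ (pow_ne_zero _ two_ne_zero)]

/-- One-box expectations: `tr(Π_{k∈S} Γ_k σ_k · Γ_j b) = tr(σ_j b)` (`j ∈ S`, density matrices on boxes indexed by `S` tiling `Λ`).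
[cite: ArakiMoriya2003, §11.1 Theorem 11.2 eq. (11.4)] -/
theorem trace_boxProd_mul_fermionEmbed_of_sum_card {σ : ∀ k, Matrix (Finset (Orb (Λ₀ k))) (Finset (Orb (Λ₀ k))) ℂ}
    (hσ : ∀ k, parityAut (σ k) = σ k) {S : Finset K} (htr : ∀ k ∈ S, (σ k).trace = 1)
    (hcard : ∑ k ∈ S, Fintype.card (Λ₀ k) = Fintype.card Λ) {j : K} (hj : j ∈ S)
    (b : Matrix (Finset (Orb (Λ₀ j))) (Finset (Orb (Λ₀ j))) ℂ) :
    (boxProd hφ σ hσ S * fermionEmbed (φ j) b).trace = (σ j * b).trace := by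
  have h := normTrace_boxProd_mul_fermionEmbed hφ hσ hj b
  rw [Finset.prod_congr rfl fun k hk => show normTrace (σ k) = ((2 : ℂ) ^ Fintype.card (Orb (Λ₀ k)))⁻¹ by
    rw [normTrace_apply, htr k (Finset.mem_of_mem_erase hk), one_div]] at h
  simp only [normTrace_apply] at h
  rw [div_eq_iff (pow_ne_zero _ two_ne_zero)] at h
  rw [h, two_pow_card_orb_eq_prod_finset hcard, ← Finset.mul_prod_erase S _ hj, Finset.prod_inv_distrib]
  have hne : ∏ k ∈ S.erase j, (2 : ℂ) ^ Fintype.card (Orb (Λ₀ k)) ≠ 0 :=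
    Finset.prod_ne_zero_iff.2 fun k _ => pow_ne_zero _ two_ne_zero
  field_simp

omit [DecidableEq K] in
/-- The `Finset`-indexed box product of faithful even density matrices is the `β = 1` Gibbs weight of the modular
Hamiltonian `H₀ = −Σ_{k∈S} Γ_k log σ_k`. [cite: Petz2008, §3.7] [cite: ArakiMoriya2003, §4.3] -/
theorem gibbsWeight_modular_eq_boxProd_finset {σ : ∀ k, Matrix (Finset (Orb (Λ₀ k))) (Finset (Orb (Λ₀ k))) ℂ}
    (hσ : ∀ k, parityAut (σ k) = σ k) (S : Finset K) (hpd : ∀ k ∈ S, (σ k).PosDef) :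
    Matrix.gibbsWeight 1 (-∑ k ∈ S, fermionEmbed (φ k) (cfc Real.log (σ k))) = boxProd hφ σ hσ S := by
  have hℓev : ∀ k, parityAut (cfc Real.log (σ k)) = cfc Real.log (σ k) :=
    fun k => parityAut_cfc_of_parityAut_eq (hσ k) Real.log
  have hsmul : -((1 : ℝ) : ℂ) • (-∑ k ∈ S, fermionEmbed (φ k) (cfc Real.log (σ k))) = ∑ k ∈ S, fermionEmbed (φ k) (cfc Real.log (σ k)) := by
    rw [Complex.ofReal_one, neg_one_smul, neg_neg]
  rw [Matrix.gibbsWeight, hsmul, Matrix.exp_sum_of_commute S (fun k => fermionEmbed (φ k) (cfc Real.log (σ k)))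
    (pairwise_commute_fermionEmbed_box hφ hℓev _)]
  unfold boxProd
  refine Finset.noncommProd_congr rfl (fun k hk => ?_) _
  rw [← fermionEmbed_exp, exp_cfc_log_of_posDef (hpd k hk)]

/-- **Entropy additivity, `Finset` form**: for FAITHFUL `Θ`-even density matrices `σ_k` (`k ∈ S`) on boxes with disjoint
images indexed by `S` and tiling `Λ` (`Σ_{k∈S} |Λ₀ k| = |Λ|`): `S(Π_{k∈S} Γ_k σ_k) = Σ_{k∈S} S(σ_k)`.
[cite: NielsenChuang2010, §11.3.4 eq. (11.58)] [cite: ArakiMoriya2003, §4.3] -/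
theorem vonNeumannEntropy_boxProd_finset {σ : ∀ k, Matrix (Finset (Orb (Λ₀ k))) (Finset (Orb (Λ₀ k))) ℂ}
    (hσ : ∀ k, parityAut (σ k) = σ k) {S : Finset K} (hpd : ∀ k ∈ S, (σ k).PosDef) (htr : ∀ k ∈ S, (σ k).trace = 1)
    (hcard : ∑ k ∈ S, Fintype.card (Λ₀ k) = Fintype.card Λ) :
    vonNeumannEntropy (boxProd hφ σ hσ S) = ∑ k ∈ S, vonNeumannEntropy (σ k) := by
  set H₀ : Matrix (Finset (Orb Λ)) (Finset (Orb Λ)) ℂ := -∑ k ∈ S, fermionEmbed (φ k) (cfc Real.log (σ k)) with hH₀def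
  have hℓherm : ∀ k, (cfc Real.log (σ k)).IsHermitian := fun k => (cfc_predicate Real.log (σ k) : IsSelfAdjoint _)
  have hH₀ : H₀.IsHermitian := by
    change (-∑ k ∈ S, fermionEmbed (φ k) (cfc Real.log (σ k)))ᴴ = -∑ k ∈ S, fermionEmbed (φ k) (cfc Real.log (σ k))
    rw [Matrix.conjTranspose_neg, Matrix.conjTranspose_sum]
    congr 1
    refine Finset.sum_congr rfl fun k _ => ?_
    rw [← fermionEmbed_conjTranspose, (hℓherm k).eq]
  have hexp : Matrix.gibbsWeight 1 H₀ = boxProd hφ σ hσ S := gibbsWeight_modular_eq_boxProd_finset hφ hσ S hpd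
  have hZ : Matrix.partitionFn 1 H₀ = 1 := by
    rw [Matrix.partitionFn, hexp, trace_boxProd_eq_one_of_sum_card hφ hσ htr hcard]
  haveI : Nonempty (Finset (Orb Λ)) := ⟨∅⟩
  have hS := hH₀.vonNeumannEntropy_gibbsDensity 1
  rw [hZ, inv_one, one_smul, hexp, gibbsEntropy_def, gibbsState_apply, hZ, Complex.one_re, Real.log_one, zero_add,
    inv_one, one_mul, one_mul, hexp] at hS
  rw [hS, hH₀def, Matrix.mul_neg, Matrix.trace_neg, Complex.neg_re, Finset.mul_sum, Matrix.trace_sum, Complex.re_sum,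
    ← Finset.sum_neg_distrib]
  refine Finset.sum_congr rfl fun k hk => ?_
  rw [trace_boxProd_mul_fermionEmbed_of_sum_card hφ hσ htr hcard hk, re_trace_mul_cfc_log (hpd k hk).1, neg_neg]

end BoxProdFinset

/-! ### §3. Region entropies of block product states -/

section BlockEntropy

variable {d : ℕ} {ι : Type*} [DecidableEq ι] (P : BlockPartition d ι)
  (ρ : (i : ι) → FermionOp (P.block i))

/-- The parts of `Λ` tile `PolySite Λ`: `Σ_{i ∈ classes Λ} |PolySite (Λ ∩ B_i)| = |PolySite Λ|`. [cite: ArakiMoriya2003, §11.1] -/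
theorem BlockPartition.sum_card_polySite_blockLoc (Λ : Finset (Site d)) :
    ∑ i ∈ P.blockClasses Λ, Fintype.card (PolySite (P.blockLoc Λ i)) = Fintype.card (PolySite Λ) := by
  simp only [Fintype.card_coe, lexSites, Finset.card_map]
  exact P.sum_card_blockLoc Λ

namespace InfVolFermionState

/-- **THE ENTROPY OF A BLOCK PRODUCT STATE ON A REGION** (faithful even block states):
`S((⊗ρ)|_Λ) = Σ_{i ∈ classes Λ} S(tr_{Λ∩B_i ⊆ B_i} ρ_i)`. [cite: ArakiMoriya2003, Theorem 3.8 and §10] [cite: NielsenChuang2010, §11.3.4 eq. (11.58)] -/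
theorem vonNeumannEntropy_rdm_blockProductState (hev : ∀ i, parityAut (ρ i) = ρ i) (hpd : ∀ i, (ρ i).PosDef)
    (htr : ∀ i, (ρ i).trace = 1) (Λ : Finset (Site d)) :
    vonNeumannEntropy ((blockProductState P ρ hev (fun i => (hpd i).posSemidef) htr).rdm Λ) =
      ∑ i ∈ P.blockClasses Λ, vonNeumannEntropy (blockMarginal P ρ Λ i) := by
  rw [rdm_blockProductState, blockDensity_def]
  exact vonNeumannEntropy_boxProd_finset (P.disjoint_map_blockEmb Λ) (parityAut_blockMarginal P hev Λ)
    (fun i _ => posDef_fermionPartialTrace _ (hpd i)) (fun i _ => by rw [trace_blockMarginal, htr])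
    (P.sum_card_polySite_blockLoc Λ)

omit [DecidableEq ι] in
/-- A density matrix has nonnegative entropy (re-export for block states). [cite: NielsenChuang2010, §11.3 (11.40)] -/
private theorem vonNeumannEntropy_nonneg_of_density {X : Finset (Site d)} {σ : FermionOp X} (hσ : σ.PosSemidef) (hσ1 : σ.trace = 1) :
    0 ≤ vonNeumannEntropy σ := vonNeumannEntropy_nonneg hσ hσ1

/-- **A full block contributes its own entropy**: if `B_i ⊆ Λ` then `S(tr_{Λ∩B_i ⊆ B_i} ρ_i) = S(ρ_i)`.
[cite: ArakiMoriya2003, Theorem 3.8 and §10] -/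
theorem vonNeumannEntropy_blockMarginal_of_block_subset (hherm : ∀ i, (ρ i).IsHermitian) {Λ : Finset (Site d)} {i : ι}
    (h : P.block i ⊆ Λ) : vonNeumannEntropy (blockMarginal P ρ Λ i) = vonNeumannEntropy (ρ i) :=
  vonNeumannEntropy_fermionPartialTrace_incl_of_eq _ (P.blockLoc_eq_block_of_subset h) (hherm i)

/-- The block marginals have nonnegative entropy. [cite: NielsenChuang2010, §11.3 (11.40)] -/
theorem vonNeumannEntropy_blockMarginal_nonneg (hpsd : ∀ i, (ρ i).PosSemidef) (htr : ∀ i, (ρ i).trace = 1)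
    (Λ : Finset (Site d)) (i : ι) : 0 ≤ vonNeumannEntropy (blockMarginal P ρ Λ i) :=
  vonNeumannEntropy_nonneg_of_density (posSemidef_blockMarginal P hpsd Λ i) (by rw [trace_blockMarginal, htr])

/-- **FULL-BLOCK LOWER BOUND**: `Σ_{i ∈ classes Λ, B_i ⊆ Λ} S(ρ_i) ≤ S((⊗ρ)|_Λ)` (partial blocks contribute nonnegative
entropies). [cite: BratteliRobinsonII1997, Thm. 6.2.40] [cite: ArakiMoriya2003, Theorem 3.8 and §10] -/
theorem sum_vonNeumannEntropy_le_rdm_blockProductState (hev : ∀ i, parityAut (ρ i) = ρ i) (hpd : ∀ i, (ρ i).PosDef)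
    (htr : ∀ i, (ρ i).trace = 1) (Λ : Finset (Site d)) [DecidablePred fun i => P.block i ⊆ Λ] :
    ∑ i ∈ (P.blockClasses Λ).filter (fun i => P.block i ⊆ Λ), vonNeumannEntropy (ρ i) ≤
      vonNeumannEntropy ((blockProductState P ρ hev (fun i => (hpd i).posSemidef) htr).rdm Λ) := by
  rw [vonNeumannEntropy_rdm_blockProductState P ρ hev hpd htr]
  calc ∑ i ∈ (P.blockClasses Λ).filter (fun i => P.block i ⊆ Λ), vonNeumannEntropy (ρ i)
      = ∑ i ∈ (P.blockClasses Λ).filter (fun i => P.block i ⊆ Λ), vonNeumannEntropy (blockMarginal P ρ Λ i) :=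
        Finset.sum_congr rfl fun i hi =>
          (vonNeumannEntropy_blockMarginal_of_block_subset P ρ (fun i => (hpd i).1) (Finset.mem_filter.1 hi).2).symm
    _ ≤ ∑ i ∈ P.blockClasses Λ, vonNeumannEntropy (blockMarginal P ρ Λ i) :=
        Finset.sum_le_sum_of_subset_of_nonneg (Finset.filter_subset _ _) fun i _ _ =>
          vonNeumannEntropy_blockMarginal_nonneg P ρ (fun i => (hpd i).posSemidef) htr Λ i

/-- **Counting form**: if `s ≤ S(ρ_i)` for every block, then `#{i ∈ classes Λ : B_i ⊆ Λ} · s ≤ S((⊗ρ)|_Λ)`.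
[cite: BratteliRobinsonII1997, Thm. 6.2.40] -/
theorem card_mul_le_vonNeumannEntropy_rdm_blockProductState (hev : ∀ i, parityAut (ρ i) = ρ i) (hpd : ∀ i, (ρ i).PosDef)
    (htr : ∀ i, (ρ i).trace = 1) (Λ : Finset (Site d)) [DecidablePred fun i => P.block i ⊆ Λ]
    {s : ℝ} (hs : ∀ i, s ≤ vonNeumannEntropy (ρ i)) :
    (((P.blockClasses Λ).filter (fun i => P.block i ⊆ Λ)).card : ℝ) * s ≤
      vonNeumannEntropy ((blockProductState P ρ hev (fun i => (hpd i).posSemidef) htr).rdm Λ) := by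
  refine le_trans ?_ (sum_vonNeumannEntropy_le_rdm_blockProductState P ρ hev hpd htr Λ)
  rw [← nsmul_eq_mul, ← Finset.sum_const]
  exact Finset.sum_le_sum fun i _ => hs i

/-- **Regions that are unions of blocks**: if every block meeting `Λ` lies in `Λ`, then
`S((⊗ρ)|_Λ) = Σ_{i ∈ classes Λ} S(ρ_i)` exactly. [cite: NielsenChuang2010, §11.3.4 eq. (11.58)] -/
theorem vonNeumannEntropy_rdm_blockProductState_of_forall_subset (hev : ∀ i, parityAut (ρ i) = ρ i) (hpd : ∀ i, (ρ i).PosDef)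
    (htr : ∀ i, (ρ i).trace = 1) {Λ : Finset (Site d)} (hΛ : ∀ i ∈ P.blockClasses Λ, P.block i ⊆ Λ) :
    vonNeumannEntropy ((blockProductState P ρ hev (fun i => (hpd i).posSemidef) htr).rdm Λ) =
      ∑ i ∈ P.blockClasses Λ, vonNeumannEntropy (ρ i) := by
  rw [vonNeumannEntropy_rdm_blockProductState P ρ hev hpd htr]
  exact Finset.sum_congr rfl fun i hi => vonNeumannEntropy_blockMarginal_of_block_subset P ρ (fun i => (hpd i).1) (hΛ i hi)

/-- **One block**: `S((⊗ρ)|_{B_i}) = S(ρ_i)` (also immediate from `rdm_blockProductState_block`).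
[cite: ArakiMoriya2003, Theorem 3.8 and §10] -/
theorem vonNeumannEntropy_rdm_blockProductState_block (hev : ∀ i, parityAut (ρ i) = ρ i) (hpsd : ∀ i, (ρ i).PosSemidef)
    (htr : ∀ i, (ρ i).trace = 1) (i : ι) :
    vonNeumannEntropy ((blockProductState P ρ hev hpsd htr).rdm (P.block i)) = vonNeumannEntropy (ρ i) := by
  rw [rdm_blockProductState_block]

end InfVolFermionState

end BlockEntropy

end Literature.MathematicalPhysics.QuantumLattice

end
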